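import Mathlib.Algebra.CharP.Two
import Literature.InformationTheory.Coding.SourcePolarizationStepProofs
import HarnessLib

/-!
# One step of source polarization, IV: the Bhattacharyya parameter under `g ↦ g⁺, g⁻`

Theorem-only companion of `Literature/InformationTheory/Coding/SourcePolarizationStep.lean`.
For a binary source with functional side information `g : ZMod 2 → Ω → β` (`Z = bhatta g`,
counts `N_b(y)`, `M = |Ω|`) and its two synthetic sources `gMinus g`, `gPlus g` on two
independent copies:

* the counts of the synthetic sources (`cnt_gMinus`, `cnt_gPlus`):
  `N⁻_u(y₁,y₂) = Σ_b N_{u+b}(y₁) N_b(y₂)`, `N⁺_d(a,y₁,y₂) = N_{a+d}(y₁) N_d(y₂)`;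
* `bhatta_gPlus` — `Z(g⁺) = Z(g)²` EXACTLY (the sum factorises) [Arıkan 2009, Prop. 5 / 7,
  equality for the plus transform with independent uniform input];
* `bhatta_gMinus_le` — `Z(g⁻) ≤ 2 Z − Z²` [Arıkan 2009, Prop. 5]: the pointwise inequality
  `√((αδ+βγ)(βδ+αγ)) ≤ √(αβ)(γ+δ) + √(γδ)(α+β) − 2√(αβγδ)` (`sqrt_mul_le_arikan`) summed over pairs
  of outputs;
* `bhatta_gMinus_ge` — `Z √(2 − Z²) ≤ Z(g⁻)`, i.e. `1 − Z(g⁻)² ≤ (1 − Z²)²`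
  [Korada–Urbanke 2010, Lemma 17 with `W₁ = W₂`]: two applications of Minkowski's inequality in
  `ℝ²` (`sqrt_sq_add_sq_sum_le`), first over `y₁` using
  `(αδ+βγ)(βδ+αγ) = (√(γδ)(α+β))² + (√(αβ)(δ−γ))²`, then over `y₂` using
  `4M²N₀N₁ + S²(N₀−N₁)² = (S(N₀+N₁))² + (2√(M²−S²)√(N₀N₁))²` (`S = M·Z ≤ M`); no channel symmetry is
  needed (equality for binary symmetric channels);
and the packaged forms `Src.zParam_plus_eq`, `Src.zParam_minus_le`, `Src.zParam_minus_ge`.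

## References

* E. Arıkan, *Channel polarization…*, IEEE Trans. IT 55 (2009), Prop. 5 (`Z(W⁻) ≤ 2Z − Z²`,
  `Z(W⁺) = Z²`) and its proof in the Appendix.  bib `Arikan2009`.
* S. B. Korada, R. Urbanke, *Polar codes are optimal for lossy source coding*, IEEE Trans. IT 56
  (2010), Lemma 17 (`Z(W⁻)² ≥ Z(W₁)² + Z(W₂)² − Z(W₁)²Z(W₂)²`, by Minkowski).  bib `KoradaUrbanke2010`.
* E. Arıkan, *Source polarization*, ISIT 2010, Prop. 1 (the source form).  bib `Arikan2010`.
-/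

noncomputable section

namespace Literature.InformationTheory.Coding.Polar

open Finset Literature.InformationTheory.Entropy

variable {Ω : Type*} [Fintype Ω] {β : Type*} [DecidableEq β]

/-! ### Counts of the synthetic sources -/

/-- Counting over the randomness `(b, w₁, w₂)` of the synthetic sources: first over the bit.
[folklore] -/
theorem card_filter_bit_prod (P : ZMod 2 → Ω → Prop) (Q : ZMod 2 → Ω → Prop)
    [∀ b, DecidablePred (P b)] [∀ b, DecidablePred (Q b)] :
    (univ.filter fun q : ZMod 2 × Ω × Ω => P q.1 q.2.1 ∧ Q q.1 q.2.2).card =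
      ∑ b, (univ.filter (P b)).card * (univ.filter (Q b)).card := by
  rw [Finset.card_filter,
    Fintype.sum_prod_type fun q : ZMod 2 × Ω × Ω => if P q.1 q.2.1 ∧ Q q.1 q.2.2 then 1 else 0]
  refine Finset.sum_congr rfl fun b _ => ?_
  rw [← Finset.card_filter, ← Finset.card_product, ← Finset.filter_product, univ_product_univ]

/-- **Counts of the minus source**: `N⁻_u(y₁, y₂) = Σ_b N_{u+b}(y₁) · N_b(y₂)`. [cite: Arikan2009, eq. (19) (W⁻(y₁y₂|u₁) = Σ ½ W(y₁|u₁+u₂) W(y₂|u₂))] -/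
theorem cnt_gMinus (g : ZMod 2 → Ω → β) (u : ZMod 2) (y₁ y₂ : β) :
    cnt (gMinus g) u (y₁, y₂) = ∑ b, cnt g (u + b) y₁ * cnt g b y₂ := by
  unfold cnt
  rw [← card_filter_bit_prod (fun b w => g (u + b) w = y₁) (fun b w => g b w = y₂)]
  congr 1
  ext q
  simp

/-- **Counts of the plus source**: `N⁺_d(a, y₁, y₂) = N_{a+d}(y₁) · N_d(y₂)` (the first copy's
bit is forced to be `a − d = a + d`). [cite: Arikan2009, eq. (20) (W⁺(y₁y₂u₁|u₂) = ½ W(y₁|u₁+u₂) W(y₂|u₂))] -/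
theorem cnt_gPlus (g : ZMod 2 → Ω → β) (d a : ZMod 2) (y₁ y₂ : β) :
    cnt (gPlus g) d (a, y₁, y₂) = cnt g (a + d) y₁ * cnt g d y₂ := by
  have key : (univ.filter fun q : ZMod 2 × Ω × Ω => gPlus g d q = (a, y₁, y₂)) =
      univ.filter fun q : ZMod 2 × Ω × Ω =>
        (q.1 = a + d ∧ g (a + d) q.2.1 = y₁) ∧ (q.1 = a + d ∧ g d q.2.2 = y₂) := by
    ext ⟨b, w₁, w₂⟩
    simp only [mem_filter, mem_univ, true_and, gPlus_apply, Prod.mk.injEq]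
    constructor
    · rintro ⟨hb, h1, h2⟩
      have hb' : b = a + d := by
        rw [← hb, add_assoc, CharTwo.add_self_eq_zero, add_zero]
      subst hb'
      exact ⟨⟨rfl, h1⟩, rfl, h2⟩
    · rintro ⟨⟨hb, h1⟩, -, h2⟩
      subst hb
      refine ⟨?_, h1, h2⟩
      rw [add_assoc, CharTwo.add_self_eq_zero, add_zero]
  unfold cnt
  rw [key, card_filter_bit_prod (fun b w => b = a + d ∧ g (a + d) w = y₁)
    (fun b w => b = a + d ∧ g d w = y₂), Finset.sum_eq_single (a + d)]
  · congr 1 <;> simp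
  · intro b _ hb
    simp [hb]
  · simp

/-- Real-valued counts of the minus source at input `0`: `N⁻₀ = N₀N₀' + N₁N₁'`. [folklore] -/
theorem cnt_gMinus_zero (g : ZMod 2 → Ω → β) (y₁ y₂ : β) :
    (cnt (gMinus g) 0 (y₁, y₂) : ℝ) = cnt g 0 y₁ * cnt g 0 y₂ + cnt g 1 y₁ * cnt g 1 y₂ := by
  rw [cnt_gMinus, sum_zmod_two]
  push_cast
  simp

/-- Real-valued counts of the minus source at input `1`: `N⁻₁ = N₁N₀' + N₀N₁'`. [folklore] -/
theorem cnt_gMinus_one (g : ZMod 2 → Ω → β) (y₁ y₂ : β) :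
    (cnt (gMinus g) 1 (y₁, y₂) : ℝ) = cnt g 1 y₁ * cnt g 0 y₂ + cnt g 0 y₁ * cnt g 1 y₂ := by
  rw [cnt_gMinus, sum_zmod_two]
  have : (1 : ZMod 2) + 1 = 0 := by decide
  rw [add_zero, this]
  push_cast
  ring

/-- The randomness of the synthetic sources has `2|Ω|²` elements. [folklore] -/
theorem card_bit_prod (Ω : Type*) [Fintype Ω] :
    (Fintype.card (ZMod 2 × Ω × Ω) : ℝ) = 2 * ((Fintype.card Ω : ℝ) * Fintype.card Ω) := by
  simp [Fintype.card_prod, ZMod.card]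

/-- The outputs of the minus source are pairs of outputs. [folklore] -/
theorem image_gMinus_subset (g : ZMod 2 → Ω → β) :
    univ.image (fun p : ZMod 2 × (ZMod 2 × Ω × Ω) => gMinus g p.1 p.2) ⊆
      univ.image (fun p : ZMod 2 × Ω => g p.1 p.2) ×ˢ univ.image (fun p : ZMod 2 × Ω => g p.1 p.2) := by
  intro y hy
  obtain ⟨u, q, rfl⟩ := (mem_image_out_iff (gMinus g) y).1 hy
  simp only [gMinus_apply, mem_product]
  exact ⟨mem_image_out g _ _, mem_image_out g _ _⟩

/-- The outputs of the plus source are a bit and a pair of outputs. [folklore] -/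
theorem image_gPlus_subset (g : ZMod 2 → Ω → β) :
    univ.image (fun p : ZMod 2 × (ZMod 2 × Ω × Ω) => gPlus g p.1 p.2) ⊆
      (univ : Finset (ZMod 2)) ×ˢ (univ.image (fun p : ZMod 2 × Ω => g p.1 p.2) ×ˢ
        univ.image (fun p : ZMod 2 × Ω => g p.1 p.2)) := by
  intro y hy
  obtain ⟨d, q, rfl⟩ := (mem_image_out_iff (gPlus g) y).1 hy
  simp only [gPlus_apply, mem_product]
  exact ⟨mem_univ _, mem_image_out g _ _, mem_image_out g _ _⟩

/-! ### `Z(g⁺) = Z(g)²` -/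

/-- **The plus transform squares the Bhattacharyya parameter**: `Z(g⁺) = Z(g)²` — for both values
of the revealed bit `a` the summand is `√(N₀N₁)(y₁) · √(N₀N₁)(y₂)`, so the sum over `(a, y₁, y₂)`
is `2 (Σ_y √(N₀N₁))²`, and `|Ω⁺| = 2|Ω|²`. [cite: Arikan2009, Prop. 5 (Z(W⁺) = Z(W)²)] -/
theorem bhatta_gPlus (g : ZMod 2 → Ω → β) : bhatta (gPlus g) = bhatta g ^ 2 := by
  rcases isEmpty_or_nonempty Ω with hΩ | hΩ
  · simp [bhatta]
  have hM : (0 : ℝ) < Fintype.card Ω := by exact_mod_cast Fintype.card_pos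
  set T := univ.image (fun p : ZMod 2 × Ω => g p.1 p.2) with hT
  rw [bhatta_eq_sum (gPlus g) _ (image_gPlus_subset g), card_bit_prod, Finset.sum_product,
    sum_zmod_two, Finset.sum_product, Finset.sum_product]
  have hterm : ∀ (a : ZMod 2) (y₁ y₂ : β),
      Real.sqrt (cnt (gPlus g) 0 (a, y₁, y₂) * cnt (gPlus g) 1 (a, y₁, y₂)) =
        Real.sqrt (cnt g 0 y₁ * cnt g 1 y₁) * Real.sqrt (cnt g 0 y₂ * cnt g 1 y₂) := by
    intro a y₁ y₂
    rw [cnt_gPlus, cnt_gPlus, ← Real.sqrt_mul (by positivity)]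
    congr 1
    push_cast
    rw [add_zero]
    rcases (by decide : ∀ a : ZMod 2, a = 0 ∨ a = 1) a with rfl | rfl
    · rw [zero_add]
      ring
    · rw [(by decide : (1 : ZMod 2) + 1 = 0)]
      ring
  simp only [hterm, ← Finset.sum_mul, ← Finset.mul_sum]
  rw [bhatta, ← hT]
  field_simp
  ring

/-! ### `Z(g⁻) ≤ 2Z − Z²` -/

/-- **Arıkan's pointwise inequality** for the minus transform, polynomial form: for nonnegative
`x, y, z, w`, `√((x²w² + y²z²)(y²w² + x²z²)) ≤ xy(z² + w²) + zw(x² + y²) − 2xyzw`; indeed the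
right side `R` is nonnegative and `R² − (x²w²+y²z²)(y²w²+x²z²) = 2xyzw((xw+yz) − (xz+yw))²`.
[cite: Arikan2009, Appendix (proof of Prop. 5, the inequality for √((αδ+βγ)(αγ+βδ)))] -/
theorem sqrt_mul_le_arikan_poly {x y z w : ℝ} (hx : 0 ≤ x) (hy : 0 ≤ y) (hz : 0 ≤ z) (hw : 0 ≤ w) :
    Real.sqrt ((x ^ 2 * w ^ 2 + y ^ 2 * z ^ 2) * (y ^ 2 * w ^ 2 + x ^ 2 * z ^ 2)) ≤
      x * y * (z ^ 2 + w ^ 2) + z * w * (x ^ 2 + y ^ 2) - 2 * (x * y) * (z * w) := by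
  have hR : 0 ≤ x * y * (z ^ 2 + w ^ 2) + z * w * (x ^ 2 + y ^ 2) - 2 * (x * y) * (z * w) := by
    have h1 : 0 ≤ x * y * (z - w) ^ 2 := by positivity
    have h2 : 0 ≤ z * w * (x ^ 2 + y ^ 2) := by positivity
    nlinarith
  rw [Real.sqrt_le_iff]
  refine ⟨hR, ?_⟩
  have h := mul_nonneg (mul_nonneg (mul_nonneg (mul_nonneg hx hy) hz) hw)
    (sq_nonneg ((x * w + y * z) - (x * z + y * w)))
  nlinarith [h]

/-- **Arıkan's pointwise inequality** for the minus transform: for nonnegative `α, β, γ, δ`,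
`√((αδ + βγ)(βδ + αγ)) ≤ √(αβ)(γ + δ) + √(γδ)(α + β) − 2√(αβ)√(γδ)`.
[cite: Arikan2009, Appendix (proof of Prop. 5)] -/
theorem sqrt_mul_le_arikan {α β γ δ : ℝ} (hα : 0 ≤ α) (hβ : 0 ≤ β) (hγ : 0 ≤ γ) (hδ : 0 ≤ δ) :
    Real.sqrt ((α * δ + β * γ) * (β * δ + α * γ)) ≤
      Real.sqrt (α * β) * (γ + δ) + Real.sqrt (γ * δ) * (α + β) -
        2 * Real.sqrt (α * β) * Real.sqrt (γ * δ) := by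
  have h := sqrt_mul_le_arikan_poly (Real.sqrt_nonneg α) (Real.sqrt_nonneg β) (Real.sqrt_nonneg γ)
    (Real.sqrt_nonneg δ)
  rw [Real.sq_sqrt hα, Real.sq_sqrt hβ, Real.sq_sqrt hγ, Real.sq_sqrt hδ, ← Real.sqrt_mul hα,
    ← Real.sqrt_mul hγ] at h
  convert h using 2

/-- **Arıkan's bound `Z(g⁻) ≤ 2 Z(g) − Z(g)²`** for the minus transform of a binary source with
functional side information (uniform input; no symmetry needed): sum the pointwise inequality
`sqrt_mul_le_arikan` over pairs of outputs; `Σ_y (N₀+N₁) = 2|Ω|`, `Σ_y √(N₀N₁) = |Ω| Z`.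
[cite: Arikan2009, Prop. 5 (Z(W⁻) ≤ 2Z(W) − Z(W)²)] -/
theorem bhatta_gMinus_le (g : ZMod 2 → Ω → β) : bhatta (gMinus g) ≤ 2 * bhatta g - bhatta g ^ 2 := by
  rcases isEmpty_or_nonempty Ω with hΩ | hΩ
  · simp [bhatta]
  have hM : (0 : ℝ) < Fintype.card Ω := by exact_mod_cast Fintype.card_pos
  set T := univ.image (fun p : ZMod 2 × Ω => g p.1 p.2) with hT
  set M : ℝ := (Fintype.card Ω : ℝ) with hMdef
  set S : ℝ := ∑ y ∈ T, Real.sqrt (cnt g 0 y * cnt g 1 y) with hS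
  have hZ : bhatta g = S / M := rfl
  have hbound : ∑ p ∈ T ×ˢ T, Real.sqrt (cnt (gMinus g) 0 p * cnt (gMinus g) 1 p) ≤
      4 * M * S - 2 * S ^ 2 := by
    calc ∑ p ∈ T ×ˢ T, Real.sqrt (cnt (gMinus g) 0 p * cnt (gMinus g) 1 p)
        ≤ ∑ p ∈ T ×ˢ T, (Real.sqrt (cnt g 0 p.1 * cnt g 1 p.1) * (cnt g 1 p.2 + cnt g 0 p.2) +
            Real.sqrt (cnt g 1 p.2 * cnt g 0 p.2) * (cnt g 0 p.1 + cnt g 1 p.1) -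
            2 * Real.sqrt (cnt g 0 p.1 * cnt g 1 p.1) * Real.sqrt (cnt g 1 p.2 * cnt g 0 p.2)) := by
          refine Finset.sum_le_sum fun p _ => ?_
          obtain ⟨y₁, y₂⟩ := p
          rw [cnt_gMinus_zero, cnt_gMinus_one]
          have h := sqrt_mul_le_arikan (α := (cnt g 0 y₁ : ℝ)) (β := cnt g 1 y₁) (γ := cnt g 1 y₂)
            (δ := cnt g 0 y₂) (Nat.cast_nonneg _) (Nat.cast_nonneg _) (Nat.cast_nonneg _)
            (Nat.cast_nonneg _)
          convert h using 2
      _ = 4 * M * S - 2 * S ^ 2 := by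
          have hswap : ∀ y, Real.sqrt ((cnt g 1 y : ℝ) * cnt g 0 y) =
              Real.sqrt (cnt g 0 y * cnt g 1 y) := fun y => by rw [mul_comm]
          simp only [hswap, Finset.sum_sub_distrib, Finset.sum_add_distrib, Finset.sum_product,
            ← Finset.mul_sum, ← Finset.sum_mul]
          rw [sum_cnt_real g 0 _ fun w => mem_image_out g 0 w,
            sum_cnt_real g 1 _ fun w => mem_image_out g 1 w, ← hMdef, ← hS]
          ring
  rw [bhatta_eq_sum (gMinus g) _ (image_gMinus_subset g), card_bit_prod, ← hMdef, hZ,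
    div_le_iff₀ (by positivity)]
  calc ∑ p ∈ T ×ˢ T, Real.sqrt (cnt (gMinus g) 0 p * cnt (gMinus g) 1 p) ≤ 4 * M * S - 2 * S ^ 2 :=
        hbound
    _ = (2 * (S / M) - (S / M) ^ 2) * (2 * (M * M)) := by
        field_simp
        ring

end Literature.InformationTheory.Coding.Polar

end
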